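import Summits.Ventures.CertifiedManyBodySolver.Rows.HubbardChainMPSTrNodesSrot
import Summits.Ventures.CertifiedManyBodySolver.Transport.MPSPrimalRaw5Srot
import HarnessLib

/-!
# Ventures/CertifiedManyBodySolver — Rows/HubbardChainMPSRaw5TrNodesSrot.lean: the `jw-srot` RAWLOW node with raw block `ρ₅` (FORMAT-ksdn v0.5
# `mps-rawlow`, χ8: `m₀ = 6`, injection `W₄`, `lmax_psd` trace bounds) and its solver-free edges

HONEST FRAMING: first certified bounds; not a superconductivity verdict; every number certified or labelled float.

Speedrun cell sr-mbsolver / programme hubbard-alg, LIT team (lit-1 gen-15), T3 of `HOME/sr-mbsolver-lit-1/lean/g15/READY-LEAN-349.md` — the CLAIM-NODE SHAPE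
for the D6 lane's RAWLOW certificates (CERTIFIED #349 χ8 n = 32, #351 χ8 n = 48 = the M1 U=8 cell mover; every χ8 `.rawlow.lmax` file has raw block
`ρ₅`, `m₀ = 6` by the exact ranks 16/58/64). It is `Rows/HubbardChainMPSTrNodesSrot.lean` (the v0.4 `mps` node `MPSChainKSDNTrNodeSrot`, raw `ρ₃`,
`W₂`, levels `4…N`) with: the raw head block `ρ₅ : Op (PolySite {-1,…,3}) 4` (LTI row `tr_{-1} ρ₅ = tr_{3} ρ₅`; coordinates `chainWindowFiveEquiv :
Fin 5 ≃ {-1,…,3}`, `i ↦ i − 1`), rows E6L / E6R through `W₄ = cgMap (castTensor A) 4`, compressed levels `ω₆ … ω_N` (chain rows from `m = 7`), and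
— in the EDGE — the a-priori bound side condition in the `λ_max` (Löwner) form `W_{m−2}ᴴW_{m−2} ≤ (B m)·𝟙` of the `lmax_psd` rule (stated over `ℂ`
for `castTensor A`; the instance carries it as its reader-checked node, FORMAT-ksdn A4). Edges: `.mono`, `.ltiChainKSDNNodeSrot` (via
`Transport.ksdnSrotClaim_of_mpsRaw5SrotTrClaim`), `.ltiChainKSDNNode`, `.m1EnergyLowerRow`, `.m1DopedEnergyLowerRow`. No `sorry`, no new axiom, no
named fact; the node is a `def … : Prop` taken as a hypothesis by the Certificates/ instances (`@[conjecture] def cert_… := MPSChainKSDNRaw5TrNodeSrot …`).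
[cite: KullEtAl2024, §2.5 eq. (TNfullRelax5), §4.2 eq. (relaxLocTIn), §6.2] [cite: ArakiMoriya2003, §4.1]
-/

noncomputable section

open Matrix Complex Filter Topology
open scoped ComplexOrder Kronecker BigOperators MatrixOrder
open Literature.Probability.LatticeModels
open Literature.MathematicalPhysics.QuantumLattice
open Literature.MathematicalPhysics.QuantumLattice.HubbardWave0
open Literature.MathematicalPhysics.QuantumLattice.ThermodynamicLimit
open Literature.MathematicalPhysics.QuantumLattice.JordanWigner
open Literature.MathematicalPhysics.QuantumManyBody.StateRelaxation
open Literature.MathematicalPhysics.QuantumLattice.MPSCoarseGraining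
open Literature.Computability.QuantumComplexity (traceLeft traceRight)
open Summit.Ventures.CertifiedManyBodySolver.Transport

namespace Summit.Ventures.CertifiedManyBodySolver

/-! ## §A  The coordinates of the five-site raw window -/

section Data

/-- **The coordinates of the five-site raw window**: `Fin 5 ≃ {-1, 0, 1, 2, 3}`, `i ↦ i − 1` (the instance's raw block `rho5` sites `1…5` are the
tree's sites `-1…3`). [folklore] -/
def chainWindowFiveEquiv : Fin 5 ≃ PolySite (chainWindow (-1) 3) where
  toFun i := PolySite.pt (fun _ => ((i : ℕ) : ℤ) - 1) (by
    rw [mem_chainWindow]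
    have hi := i.2
    show -1 ≤ ((i : ℕ) : ℤ) - 1 ∧ ((i : ℕ) : ℤ) - 1 ≤ 3
    omega)
  invFun y := ⟨(ofLex y.1 0 + 1).toNat, by
    have h := mem_chainWindow.1 (PolySite.ofLex_mem y)
    have h1 : ((ofLex y.1 0 + 1).toNat : ℤ) = ofLex y.1 0 + 1 := Int.toNat_of_nonneg (by omega)
    omega⟩
  left_inv i := Fin.ext (by
    show ((((i : ℕ) : ℤ) - 1) + 1).toNat = (i : ℕ)
    rw [sub_add_cancel, Int.toNat_natCast])
  right_inv y := polySite_eq_of_coord_eq (by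
    have h := mem_chainWindow.1 (PolySite.ofLex_mem y)
    have h1 : ((ofLex y.1 0 + 1).toNat : ℤ) = ofLex y.1 0 + 1 := Int.toNat_of_nonneg (by omega)
    show (((ofLex y.1 0 + 1).toNat : ℕ) : ℤ) - 1 = ofLex y.1 0
    omega)

/-- The coordinates of `chainWindowFiveEquiv`: `i ↦ i − 1`. [folklore] -/
@[simp] theorem chainWindowFiveEquiv_coord (i : Fin 5) : ofLex (chainWindowFiveEquiv i).1 0 = ((i : ℕ) : ℤ) - 1 := rfl

end Data

/-! ## §B  The node predicate (window `{-1, …, n+1}` of `N = n + 3 ≥ 6` sites, raw block `ρ₅`, bond dimension `D`, model `hubbard_jwsrot(U)`, `t = 1`) -/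

section Nodes

/-- **`jw-srot` `relax = mps-rawlow(N, D, A)` node with raw block `ρ₅` and TRACE BOUNDS, `ksdn-inst/1` v0.5 form** (the `hclaim` of
`Transport.ksdnSrotClaim_of_mpsRaw5SrotTrClaim` at `t = 1` with rational data): for all variables `ρ₅ : Op (PolySite {-1,…,3}) 4` and `ω m`
(`6 ≤ m ≤ n + 3`, indexed `(s_L, (a,b), s_R)`), IF `ρ₅ ⪰ 0`, `tr ρ₅ = 1`, the LTI row `tr_{-1} ρ₅ = tr_{3} ρ₅`, the TOTAL-OCCUPATION sector zeros, the
total density of site `-1` equal to `ν`, real entries, `|ρ₅| ≤ 1`; rows E6L / E6R (through `chainWindowFiveEquiv`, `W₄ = cgMap (castTensor A) 4`), E_mL /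
E_mR for `7 ≤ m ≤ n+3`; `ω_m ⪰ 0`, sector zeros for `cgTag (hubbardSrotQeff cb ca) qb`, real entries, `|ω_m| ≤ B m` AND `Re tr ω_m ≤ B m` (`6 ≤ m ≤ n+3`)
— THEN `lo ≤ Re tr(toSpin(U n_{-1↑}n_{-1↓} − Σ_σ (c†_{-1σ} c_{0σ̄} + c†_{0σ̄} c_{-1σ})) ρ₅)`. VERBATIM `MPSChainKSDNTrNodeSrot` with `ρ₃ → ρ₅`, `W₂ → W₄`,
levels `4… → 6…`. By-name audit token: predicate NAME + `(U, n + 3 = the file's n, D, ν, lo)` + the tables `A`, `qb`, `(cb, ca)`, `B m` (=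
`bounds.levels[m].r`, m ≥ 6). [cite: KullEtAl2024, §2.5 eq. (TNfullRelax5), §4.2 eq. (relaxLocTIn), §6.2] -/
def MPSChainKSDNRaw5TrNodeSrot (U : ℝ) (n D : ℕ) (A : Fin 4 → Matrix (Fin D) (Fin D) ℚ) (qb : Fin D → ℤ) (cb ca : ℤ) (B : ℕ → ℚ)
    (ν lo : ℚ) : Prop :=
  ∀ (ρ₅ : Op (PolySite (chainWindow (-1) 3)) 4)
    (ω : ℕ → Matrix (Fin 4 × ((Fin D × Fin D) × Fin 4)) (Fin 4 × ((Fin D × Fin D) × Fin 4)) ℂ),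
    ρ₅.PosSemidef → ρ₅.trace = 1 →
    spinPartialTrace ((PolySite.affEmb 1 (unitVec 0) (chainWindow (-1) 2)).trans
        (PolySite.incl affShiftSet_chainWindow_two_subset_three)) ρ₅ =
      spinPartialTrace (PolySite.incl chainWindow_two_subset_three) ρ₅ →
    (∀ k k' : TensorIndex (PolySite (chainWindow (-1) 3)) 4,
      (∑ x, (siteOcc (k x)).card) ≠ (∑ x, (siteOcc (k' x)).card) → ρ₅ k k' = 0) →
    ((toSpin (nAt (-unitVec 0) neg_unitVec_mem_chainWindow_three 0 + nAt (-unitVec 0) neg_unitVec_mem_chainWindow_three 1) *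
        ρ₅).trace).re = ((ν : ℚ) : ℝ) →
    (∀ k k' : TensorIndex (PolySite (chainWindow (-1) 3)) 4, starRingEnd ℂ (ρ₅ k k') = ρ₅ k k') →
    (∀ k k' : TensorIndex (PolySite (chainWindow (-1) 3)) 4, ‖ρ₅ k k'‖ ≤ 1) →
    traceLeft (ω 6) = (cgMap (castTensor A) 4 ⊗ₖ (1 : Matrix (Fin 4) (Fin 4) ℂ)) *
        (ρ₅.submatrix (Equiv.arrowCongr chainWindowFiveEquiv (Equiv.refl (Fin 4)))
            (Equiv.arrowCongr chainWindowFiveEquiv (Equiv.refl (Fin 4)))).submatrix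
          ((Equiv.prodComm _ _).trans (Fin.snocEquiv fun _ => Fin 4))
          ((Equiv.prodComm _ _).trans (Fin.snocEquiv fun _ => Fin 4)) *
      (cgMap (castTensor A) 4 ⊗ₖ (1 : Matrix (Fin 4) (Fin 4) ℂ))ᴴ →
    traceRight ((ω 6).submatrix (Equiv.prodAssoc _ _ _) (Equiv.prodAssoc _ _ _)) =
      ((1 : Matrix (Fin 4) (Fin 4) ℂ) ⊗ₖ cgMap (castTensor A) 4) *
        (ρ₅.submatrix (Equiv.arrowCongr chainWindowFiveEquiv (Equiv.refl (Fin 4)))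
            (Equiv.arrowCongr chainWindowFiveEquiv (Equiv.refl (Fin 4)))).submatrix
          (Fin.consEquiv fun _ => Fin 4) (Fin.consEquiv fun _ => Fin 4) *
      ((1 : Matrix (Fin 4) (Fin 4) ℂ) ⊗ₖ cgMap (castTensor A) 4)ᴴ →
    (∀ k, k + 7 ≤ n + 3 → traceLeft (ω (k + 7)) =
      (leftMap (castTensor A) ⊗ₖ (1 : Matrix (Fin 4) (Fin 4) ℂ)) *
        (ω (k + 6)).submatrix (Equiv.prodAssoc _ _ _) (Equiv.prodAssoc _ _ _) *
      (leftMap (castTensor A) ⊗ₖ (1 : Matrix (Fin 4) (Fin 4) ℂ))ᴴ) →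
    (∀ k, k + 7 ≤ n + 3 → traceRight ((ω (k + 7)).submatrix (Equiv.prodAssoc _ _ _) (Equiv.prodAssoc _ _ _)) =
      ((1 : Matrix (Fin 4) (Fin 4) ℂ) ⊗ₖ rightMap (castTensor A)) * ω (k + 6) *
      ((1 : Matrix (Fin 4) (Fin 4) ℂ) ⊗ₖ rightMap (castTensor A))ᴴ) →
    (∀ k, k + 6 ≤ n + 3 → (ω (k + 6)).PosSemidef) →
    (∀ k, k + 6 ≤ n + 3 → ∀ i j, cgTag (hubbardSrotQeff cb ca) qb i ≠ cgTag (hubbardSrotQeff cb ca) qb j → ω (k + 6) i j = 0) →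
    (∀ k, k + 6 ≤ n + 3 → ∀ i j, starRingEnd ℂ (ω (k + 6) i j) = ω (k + 6) i j) →
    (∀ k, k + 6 ≤ n + 3 → ∀ i j, ‖ω (k + 6) i j‖ ≤ ((B (k + 6) : ℚ) : ℝ)) →
    (∀ k, k + 6 ≤ n + 3 → ((ω (k + 6)).trace).re ≤ ((B (k + 6) : ℚ) : ℝ)) →
    ((lo : ℚ) : ℝ) ≤ ((toSpin ((U : ℂ) • (nAt (-unitVec 0) neg_unitVec_mem_chainWindow_three 0 *
          nAt (-unitVec 0) neg_unitVec_mem_chainWindow_three 1) +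
        (-((1 : ℝ) : ℂ)) • ∑ σ : Fin 2,
          ((cAt (-unitVec 0) neg_unitVec_mem_chainWindow_three σ)ᴴ * cAt 0 zero_mem_chainWindow_three σ.rev +
            (cAt 0 zero_mem_chainWindow_three σ.rev)ᴴ * cAt (-unitVec 0) neg_unitVec_mem_chainWindow_three σ)) * ρ₅).trace).re

end Nodes

/-! ## §C  Solver-free edges -/

section Edges

variable {U : ℝ} {n D : ℕ} {A : Fin 4 → Matrix (Fin D) (Fin D) ℚ} {qb : Fin D → ℤ} {cb ca : ℤ} {B : ℕ → ℚ} {ν lo lo' : ℚ}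

/-- A node survives a SMALLER slot `lo' ≤ lo`. -/
theorem MPSChainKSDNRaw5TrNodeSrot.mono (h : MPSChainKSDNRaw5TrNodeSrot U n D A qb cb ca B ν lo) (hlo : lo' ≤ lo) :
    MPSChainKSDNRaw5TrNodeSrot U n D A qb cb ca B ν lo' :=
  fun ρ₅ ω h1 h2 h3 h4 h5 h6 h7 h8 h9 h10 h11 h12 h13 h14 h15 h16 =>
    le_trans (by exact_mod_cast hlo) (h ρ₅ ω h1 h2 h3 h4 h5 h6 h7 h8 h9 h10 h11 h12 h13 h14 h15 h16)

/-- **THE RAWLOW EDGE BY NAME: a `jw-srot` `mps-rawlow` (`ρ₅`) certificate is a `jw-srot` `lti(N)` certificate** (`N = n + 3 ≥ 6`): under the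
side conditions (charge covariance of `A` for `hubbardSrotQeff cb ca`; the `lmax_psd` rule `W_{m−2}ᴴW_{m−2} ≤ (B m)·𝟙`, `0 ≤ B m`, m = 6…N, over `ℂ`
for `castTensor A`), `MPSChainKSDNRaw5TrNodeSrot U n D A qb cb ca B ν lo → LTIChainKSDNNodeSrot U n ν lo`. Solver-free: KSDN's feasible point
(`Transport.ksdnSrotClaim_of_mpsRaw5SrotTrClaim`). [cite: KullEtAl2024, §4.2] -/
theorem MPSChainKSDNRaw5TrNodeSrot.ltiChainKSDNNodeSrot (h : MPSChainKSDNRaw5TrNodeSrot U n D A qb cb ca B ν lo) (hn : 3 ≤ n)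
    (hAcov : ∀ s a b, A s a b ≠ 0 → qb b = qb a + hubbardSrotQeff cb ca s)
    (hB : ∀ k, k + 6 ≤ n + 3 → 0 ≤ ((B (k + 6) : ℚ) : ℝ) ∧
      (cgMap (castTensor A) (k + 4))ᴴ * cgMap (castTensor A) (k + 4) ≤
        ((B (k + 6) : ℚ) : ℝ) • (1 : Matrix (Fin (k + 4) → Fin 4) (Fin (k + 4) → Fin 4) ℂ)) :
    LTIChainKSDNNodeSrot U n ν lo :=
  ksdnSrotClaim_of_mpsRaw5SrotTrClaim 1 U n hn (castTensor A) (star_castTensor_apply A) qb cb ca (mpsCovSrot_of_rat hAcov)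
    (fun m => ((B m : ℚ) : ℝ)) hB chainWindowFiveEquiv chainWindowFiveEquiv_coord h

/-- **`jw-srot` `mps-rawlow` certificate ⇒ standard `lti(N)` certificate** (composite edge through `LTIChainKSDNNodeSrot`). [cite: KullEtAl2024, §4.2, §VI.B] -/
theorem MPSChainKSDNRaw5TrNodeSrot.ltiChainKSDNNode (h : MPSChainKSDNRaw5TrNodeSrot U n D A qb cb ca B ν lo) (hn : 3 ≤ n)
    (hAcov : ∀ s a b, A s a b ≠ 0 → qb b = qb a + hubbardSrotQeff cb ca s)
    (hB : ∀ k, k + 6 ≤ n + 3 → 0 ≤ ((B (k + 6) : ℚ) : ℝ) ∧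
      (cgMap (castTensor A) (k + 4))ᴴ * cgMap (castTensor A) (k + 4) ≤
        ((B (k + 6) : ℚ) : ℝ) • (1 : Matrix (Fin (k + 4) → Fin 4) (Fin (k + 4) → Fin 4) ℂ)) :
    LTIChainKSDNNode U n ν lo :=
  (h.ltiChainKSDNNodeSrot hn hAcov hB).ltiChainKSDNNode

end Edges

/-! ## §D  The M1 cells BY NAME -/

section Cells

variable {U : ℝ} {n D : ℕ} {A : Fin 4 → Matrix (Fin D) (Fin D) ℚ} {qb : Fin D → ℤ} {cb ca : ℤ} {B : ℕ → ℚ} {ν lo : ℚ} {p q : ℕ}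

/-- **M1 cell BY NAME** (`ν = 1`, `U ≥ 0`): a `jw-srot` rawlow node at half filling ⇒ `lo ≤ e₀(U)` (`M1EnergyLowerRow U lo`). -/
theorem MPSChainKSDNRaw5TrNodeSrot.m1EnergyLowerRow (h : MPSChainKSDNRaw5TrNodeSrot U n D A qb cb ca B 1 lo) (hn : 3 ≤ n) (hU : 0 ≤ U)
    (hAcov : ∀ s a b, A s a b ≠ 0 → qb b = qb a + hubbardSrotQeff cb ca s)
    (hB : ∀ k, k + 6 ≤ n + 3 → 0 ≤ ((B (k + 6) : ℚ) : ℝ) ∧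
      (cgMap (castTensor A) (k + 4))ᴴ * cgMap (castTensor A) (k + 4) ≤
        ((B (k + 6) : ℚ) : ℝ) • (1 : Matrix (Fin (k + 4) → Fin 4) (Fin (k + 4) → Fin 4) ℂ)) :
    M1EnergyLowerRow U lo :=
  (h.ltiChainKSDNNodeSrot hn hAcov hB).m1EnergyLowerRow hU

/-- **M1 doped cell BY NAME** (`ν = p/q`, `1 ≤ q`, `p ≤ 2q`, `U ≥ 0`): `lo ≤ e₀(U, n = p/q)` (`M1DopedEnergyLowerRow U p q lo`). -/
theorem MPSChainKSDNRaw5TrNodeSrot.m1DopedEnergyLowerRow (h : MPSChainKSDNRaw5TrNodeSrot U n D A qb cb ca B ν lo) (hn : 3 ≤ n)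
    (hU : 0 ≤ U) (hq : 1 ≤ q) (hp : p ≤ 2 * q) (hν : ((ν : ℚ) : ℝ) = (p : ℝ) / (q : ℝ))
    (hAcov : ∀ s a b, A s a b ≠ 0 → qb b = qb a + hubbardSrotQeff cb ca s)
    (hB : ∀ k, k + 6 ≤ n + 3 → 0 ≤ ((B (k + 6) : ℚ) : ℝ) ∧
      (cgMap (castTensor A) (k + 4))ᴴ * cgMap (castTensor A) (k + 4) ≤
        ((B (k + 6) : ℚ) : ℝ) • (1 : Matrix (Fin (k + 4) → Fin 4) (Fin (k + 4) → Fin 4) ℂ)) :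
    M1DopedEnergyLowerRow U p q lo :=
  (h.ltiChainKSDNNodeSrot hn hAcov hB).m1DopedEnergyLowerRow hU hq hp hν

end Cells

end Summit.Ventures.CertifiedManyBodySolver

end
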